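import Mathlib
import Summits.NavierStokesRegularity.NavierStokesRegularity.Theorems.DssFarFieldSlavingBlowupTypeIDssProfileGaussianTwoConstantCore
import Summits.NavierStokesRegularity.NavierStokesRegularity.Theorems.DssFarFieldSlavingBlowupTypeIDssProfileGaussianTypeIPackage
import Summits.NavierStokesRegularity.NavierStokesRegularity.Theorems.DssFarFieldSlavingBlowupTypeIDssProfileSmoothRepresentativeAe
import HarnessLib

/-!
# The Gaussian two-constant Liouville theorem (theory T31′) and the two-constant PORTRAIT FLOOR at CLASS
  level, UNCONDITIONALLY (pub-ns-dss T38/T31 scope Row 4; route `DssFarFieldSlaving`, crux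
  `BlowupTypeIDssProfile`, stmt-NavierStokesRegularity-0155 — SUPPORT, LABEL-BEARING; typer seat g7,
  2026-08-23; theory g10 recommendation INBOX l.1632, lead A215 scope)

HONEST FRAMING. Exclusion statements about a HYPOTHETICAL object (a Type-I ancient mild solution / a
member of the rotated-DSS Type-I class). CLASSICAL (theory T31′, «Gaussian two-constant»): a
KNSS-gauge Type-I field with time-only constant `Mt` (`‖V(t,x)‖ ≤ Mt/√(−t)`, the constant of
`IsTypeIAncientMild` itself) and space-only constant `A` (`‖x‖‖V(t,x)‖ ≤ A`) with `Mt² + 3A < 4`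
vanishes — NO decay hypothesis (D), NO named input. CLASS: the space–time envelope
`‖u(t,x)‖ ≤ M/(‖x‖ + √(−t))` (`HasTypeIDecay M u`, hypothesis H of `RdssProfileTruncation`) gives BOTH
`Mt ≤ M` and `A ≤ M` for the smooth KNSS representative, and `M² + 3M < 4 ⇔ M < 1` (`M ≥ 0`); hence
the hypothesis class is EMPTY for every `M < 1` — that statement is now the tree's
`SimilarityEnstrophy.rdssClass_empty_of_typeI_lt_one` ((D)-discharge) and is NOT restated here; this
file records T31′'s non-redundant content: the CLASSICAL two-constant slice and the class-level JOINT
PORTRAIT FLOOR `Mt² + 3A ≥ 4` for survivors (`rdssClass_empty_of_twoConstant`; theory g10 l.1715);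
classically the three typed slices stay pairwise incomparable (Row 2: `Mt < 1` given (D), now
unconditional for the space–time class; T31′: `Mt² + 3A < 4`; T31-G: `Mt < m₀ ≈ 0.32`). MECHANISM (the
monotone quantity): the Gaussian enstrophy `E(s) = ∫K|Ω|²`, `½E′ ≤ −(1 − Mt²/4 − 3A/4)E`
(`gaussianEnstrophy_pairing_le_of_twoConstant`: O-U cancellation, Gaussian transport and stretching
identities, the two `y`-weighted terms cost `¾A·E`, the stretching remainder `Mt√D√E ≤ D + (Mt²/4)E`).
DSS-BLIND: the class proof discards `c`, `R`, `IsRotatedDSS`. Derivation: theory seat (T31′, theory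
g4 2026-08-22, ×2 theory g10); typed here on the T31-G kit. Census words on ACCEPT are the lead's.
PRINTED CONTEXT: comparators only, all existential (lit LIT-COVERAGE §18/§35). Nothing numeric
about any candidate; nothing here bears on Navier–Stokes regularity or blow-up.
-/

noncomputable section

set_option linter.dupNamespace false

namespace Summit.NavierStokesRegularity.NavierStokesRegularity.Theorems.GaussianGap

open Set Function Filter MeasureTheory InnerProductSpace Real Metric
open scoped RealInnerProductSpace Laplacian ContDiff Topology BigOperators
open Literature.Analysis Literature.Analysis.FluidPDE Literature.Analysis.UnboundedOperators
open Summit.NavierStokesRegularity.NavierStokesRegularity.Theorems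

variable {V : ℝ → EuclideanSpace ℝ (Fin 3) → EuclideanSpace ℝ (Fin 3)}

/-- **T31′ — the Gaussian two-constant Liouville theorem, CLASSICAL level** (theory g4 2026-08-22,
×2 theory g10 2026-08-23; typed on the T31-G kit). Let `V` be a Type-I ancient mild field in the
KNSS gauge with time-only constant `Mt` (`IsTypeIAncientMild Mt V`, `‖U‖ ≤ Mt` in similarity
variables) and space-only constant `A` (`‖x‖‖V(t,x)‖ ≤ A` for all `t < 0`, `x`, i.e. `‖y‖‖U(s,y)‖ ≤ A`).
If `Mt² + 3A < 4` then `V ≡ 0` on `t < 0`. NO decay hypothesis (D): Gaussian weight + the tree's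
class-uniform gauge bounds (`…GaussianTypeIPackage`) + `gaussianTwoConstant_vorticity_liouville`.
[this file; theory T31′ (LIOUVILLE-SIDE §8); census words on ACCEPT are the lead's; nothing here bears
on NS regularity] -/
theorem typeI_ancient_eq_zero_of_gaussianTwoConstant {Mt A : ℝ} (hV : IsTypeIAncientMild Mt V)
    (hA : ∀ t < 0, ∀ x, ‖x‖ * ‖V t x‖ ≤ A) (h : Mt ^ 2 + 3 * A < 4) :
    ∀ t < 0, ∀ x, V t x = 0 := by
  obtain ⟨hΩ2, hU1, hdiv, hdivΩ, hbdd, heq, hUM⟩ := similarity_package hV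
  obtain ⟨B, hZ⟩ := exists_integral_heatKernel_norm_lerayVorticity_sq_le hV
  exact eq_zero_of_lerayVorticity_eq_zero hV
    (gaussianTwoConstant_vorticity_liouville (Ω := lerayVorticity V) (U := lerayOrbit V) hΩ2 hU1 hdiv
      hdivΩ hbdd heq hV.nonneg hUM (norm_mul_norm_lerayOrbit_le hA) h hZ)

/-- **The joint portrait floor at CLASS level** (theory g10 l.1715: T31′'s non-redundant content after
the (D)-discharge): every member of the hypothesis class of `RdssProfileTruncation` with Type-I
space–time constant `M` whose smooth KNSS representatives ALL have time-only constant `Mt` and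
space-only constant `A` with `Mt² + 3A < 4` is trivial — i.e. the class restricted to
`{Mt² + 3A < 4}` is EMPTY, UNCONDITIONALLY (representatives quantified as in the E29 wrapper).
The plain `M < 1` class statement is the tree's `SimilarityEnstrophy.rdssClass_empty_of_typeI_lt_one`
((D)-discharge) and is not restated here. DSS-blind. [this file; theory T31′; census words on
ACCEPT are the lead's; nothing numerical is asserted and nothing here bears on NS regularity] -/
theorem rdssClass_empty_of_twoConstant (M : ℝ) {Mt A : ℝ} (h : Mt ^ 2 + 3 * A < 4) :
    ¬ ∃ (c : ℝ) (R : (EuclideanSpace ℝ (Fin 3)) ≃ₗᵢ[ℝ] (EuclideanSpace ℝ (Fin 3)))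
        (u : ℝ → (EuclideanSpace ℝ (Fin 3)) → (EuclideanSpace ℝ (Fin 3))),
      1 < c ∧ IsAncientMildSolution 1 u ∧ (∀ t < 0, AEStronglyMeasurable (u t) volume) ∧
      IsRotatedDSS c R u ∧ HasTypeIDecay M u ∧
      (∀ V : ℝ → EuclideanSpace ℝ (Fin 3) → EuclideanSpace ℝ (Fin 3), IsTypeIAncientMild M V →
        (∀ t < 0, V t =ᵐ[volume] u t) →
        IsTypeIAncientMild Mt V ∧ ∀ t < 0, ∀ x, ‖x‖ * ‖V t x‖ ≤ A) ∧
      ¬ (∀ t < 0, u t =ᵐ[volume] 0) := by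
  rintro ⟨c, R, u, -, hmild, hmeas, -, hdec, hMtA, hne⟩
  obtain ⟨V, hT, -, hVu, -⟩ := typeI_ancient_smoothRepresentative_ae hmild hmeas hdec
  obtain ⟨hMt, hA⟩ := hMtA V hT hVu
  have hz : ∀ t < 0, ∀ x, V t x = 0 := typeI_ancient_eq_zero_of_gaussianTwoConstant hMt hA h
  refine hne fun t ht => ?_
  have hVz : V t = 0 := funext fun x => by simpa using hz t ht x
  exact (hVu t ht).symm.trans (Filter.EventuallyEq.of_eq hVz)

end Summit.NavierStokesRegularity.NavierStokesRegularity.Theorems.GaussianGap
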